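import Summits.BirchSwinnertonDyer.BirchSwinnertonDyer.Theorems.ErratumRoadFiveIMCDivRoadFFSigmaDataBNoDefect
import Literature.NumberTheory.EllipticCurves.JetchevSkinnerWan2017.SigmaLocalCharIdealProofs
import HarnessLib

/-!
# Route `UniversalToricDescent`, cruxes `TwinSplitIMCAtThreeMult` (stmt-BirchSwinnertonDyer-20694, bucket B) and ♭B
# `TwinWanFrameAtThreeMult` (stmt-BirchSwinnertonDyer-26062), lines `threeframes` / `membertower`, stub `stub_sigmaDataMult`:
# the twin's Road-FF `Σ`-DATA under an ALL-SPLIT Heegner field REDUCES to the torsion of `X^∅_ac` (two published facts)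

Cell `bsd-wall` (run/shared/lean/pub/bsd-wall/), seat `bsd-wall-utd-p2` (lead prover g11, 2026-08-28);
`--supports stmt-BirchSwinnertonDyer-20694 --as helper`; Theses-free (the twin binders are spelled out).

## What this file proves

The registered stub `stub_sigmaDataMult` of both skeletons asks, at the X-slot `𝔭' ∋ 3` of every datum of the
3-multiplicative twin `W′` under the route's ALL-SPLIT Heegner field `K`, for the Road-FF `Σ`-data
`P2.RoadFF.SigmaDataAt W′ 3 κ 𝔭' γ Σ(W′,3)(K) P_Σ` = `Σ` finite ∧ `X^Σ_ac(W′)` torsion ∧ `P_Σ ≠ 0` ∧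
`Ch(X^∅)·(P_Σ) ⊆ Ch(X^Σ)`. Cell bsd-stepL derived exactly this shape for `E` at an erratum datum (`p ≥ 5`) from (i) the
LOCAL published fact `JetchevSkinnerWan2017.sigmaLocal_charIdeal_eulerFactor_mem_of_noTamagawaDefect`, (ii) Shapiro
[SU14 Prop. 3.2.3] and (iii) the torsion of `X^∅_ac` (`…SigmaDataBOfSigmaLocal`, p ≥ 5 only through the erratum datum
and the no-defect residual). Here:

* §1 **`noTamagawaDefect_sigmaPlaces_of_satisfiesHeegnerHypothesis`** — for ANY `E/ℚ`, odd `p`, `K` imaginary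
  quadratic in which EVERY prime of the conductor splits (`SatisfiesHeegnerHypothesis N K`, the CLASSICAL Heegner
  hypothesis) and `κ` anticyclotomic: NO place of `Σ(E,p)(K)` carries a Tamagawa defect — each lies over a split
  `ℓ ∣ N`, has degree one, hence is finitely decomposed in `K_∞^ac` (`frobExponentAt ≠ 0`), and the defect clause is
  vacuous (`noTamagawaDefect_of_ne_zero`). (At `p = 3` this also disposes of the `t ≠ additive` clause, which the
  tree's `noTamagawaDefect_sigmaPlaces_of_splitMult_imp_degree_one` avoided by asking `3 < p`.)
* §2 **`P2.RoadFF.sigmaDataAt_of_isTorsion_empty_of_satisfiesHeegnerHypothesis`** — for `p ≥ 3` split in such a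
  `K`, any slot `𝔭 ∋ p`: torsion of `X^∅_ac(E; slot 𝔭)` + (i) + (ii) ⟹ `P2.RoadFF.SigmaDataAt E p κ 𝔭 γ Σ P_Σ`.
* §3 **`twin_sigmaDataAt_of_isTorsion_empty`** — the specialisation to the binders of `stub_sigmaDataMult` (`Mult W′ 3`,
  conductor `N′`, `SatisfiesHeegnerHypothesis N′ K`, slot `𝔭' ∋ 3`): the stub's research content is EXACTLY
  «`X^∅_ac(W′/K_∞; slot 𝔭')` is `Λ`-torsion» (the Heegner side at `3 ∥ N′`), the rest is published.

HONEST FRAMING: theorems only (no definition, no named fact, no instance, no `sorry`); CONDITIONAL on the two PUBLISHED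
named facts displayed as hypotheses and on the torsion input; nothing is booked; BSD is proved for no curve; no census
number moves.

References: [JetchevSkinnerWan2017] §5.1, proof of Thm. 6.1.6 (the `Σ`-local display); [SkinnerUrban2014] Prop. 3.2.3;
[Castella2018] Def. 2.2, (2.7), Prop. 2.5 (`ℋ^ur_v = 0` at places split in `K`, `t_E(w) = ord_p c_w`); [GrossLMS1991] §1
(Heegner hypothesis); [Brink2007] Thm. 2 (decomposition in the anticyclotomic tower).
-/

set_option autoImplicit false

noncomputable section

open scoped Classical

open WeierstrassCurve NumberField IsDedekindDomain Field PowerSeries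
open Literature.NumberTheory.EllipticCurves Literature.NumberTheory.EllipticCurves.GreenbergSelmer
  Literature.NumberTheory.EllipticCurves.ModularForms Literature.NumberTheory.EllipticCurves.Rank1Residual
  Literature.NumberTheory.EllipticCurves.Rank1Residual.Typed Literature.NumberTheory.EllipticCurves.Castella2018
  Literature.NumberTheory.EllipticCurves.JetchevSkinnerWan2017 Literature.NumberTheory.GaloisRepresentations
  Literature.NumberTheory.GaloisCohomology
open Summit.BirchSwinnertonDyer.Rank1Residual.X11b.AcSelmer Summit.BirchSwinnertonDyer.Rank1Residual.X11b.Halves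
open Summit.BirchSwinnertonDyer.Rank1Residual

namespace Summit.BirchSwinnertonDyer.Rank1Residual.X11b

section AllSplit

variable (W : WeierstrassCurve ℚ) [W.IsElliptic] (p : ℕ) [Fact p.Prime]
  {K : Type} [Field K] [NumberField K]

/-! ### §1 No Tamagawa defect on `Σ` under the classical (all-split) Heegner hypothesis -/

/-- **No place of `Σ(E,p)(K)` carries a Tamagawa defect when every prime of the conductor splits in `K`.** For `E/ℚ`
globally minimal, `p` odd, `K` imaginary quadratic with `SatisfiesHeegnerHypothesis N_E K` and `κ` anticyclotomic: a place
`w ∈ Σ(E,p)(K)` lies over a prime `ℓ ∣ N_E`, `ℓ ≠ p` (`exists_prime_mem_of_mem_sigmaPlacesFinset`), which splits in `K`,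
so `w` has degree one (`degreeOne_of_splitsIn`), is finitely decomposed in `K_∞^ac` (`frobExponentAt_ne_zero_of_degree_one`),
and the defect clause — only about places totally split in `K_∞^ac` — is void (`noTamagawaDefect_of_ne_zero`).
[cite: Castella2018, Prop. 2.5 with its proof ("for primes v ∤ p which are split in K … ℋ^ur_v vanishes")]
[cite: GrossLMS1991, §1 (p. 235) (the Heegner hypothesis: every prime of N splits)] -/
theorem noTamagawaDefect_sigmaPlaces_of_satisfiesHeegnerHypothesis (hp2 : p ≠ 2) (hK : IsImaginaryQuadratic K)
    (hH : SatisfiesHeegnerHypothesis (W.conductorNorm ℤ) K) (κ : ZpExtension K p) (hκ : κ.IsAnticyclotomic) :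
    ∀ w ∈ W.sigmaPlacesFinset p K,
      NoTamagawaDefect p ((W.baseChange K).localReductionDataAt w) (κ.frobExponentAt w) := by
  intro w hw
  obtain ⟨ℓ, hℓ, hℓN, -, hℓw⟩ := exists_prime_mem_of_mem_sigmaPlacesFinset W p hw
  haveI : Fact ℓ.Prime := ⟨hℓ⟩
  have hsplit : SplitsIn K ℓ := hH ℓ hℓ hℓN
  obtain ⟨he, hf⟩ := degreeOne_of_splitsIn hK.1 hsplit hℓw
  exact noTamagawaDefect_of_ne_zero
    (κ.frobExponentAt_ne_zero_of_degree_one hK hp2 hκ (W.forall_mem_sigmaPlacesFinset_not_mem p K w hw) he hf)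

/-! ### §2 The Road-FF `Σ`-data from the torsion of `X^∅_ac` -/

/-- **ROAD-FF `Σ`-DATA FROM THE TORSION OF `X^∅_ac` UNDER THE CLASSICAL HEEGNER HYPOTHESIS.** For `E/ℚ` globally
minimal, `p ≥ 3` split in the imaginary quadratic `K`, every prime of `N_E` split in `K`, `κ` anticyclotomic with
generator `γ`, any slot `𝔭 ∋ p`: if `X^∅_ac(E/K_∞; slot 𝔭)` is `Λ`-torsion then
`P2.RoadFF.SigmaDataAt E p κ 𝔭 γ Σ(E,p)(K) P_Σ` — `Σ` finite; `X^Σ_ac` torsion and `Ch(X^∅)·(P_Σ) ⊆ Ch(X^Σ)`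
(`JetchevSkinnerWan2017.isTorsion_XAc_and_charIdeal_empty_mul_le_of_sigmaLocal_of_prop323` from the LOCAL fact `hloc`
and Shapiro `h323`, the no-defect binder by §1, the Euler data by `isEulerDataAt_of_mem_sigmaPlacesFinset`); `P_Σ ≠ 0`
(`sigmaEulerElement_ne_zero`). CONDITIONAL on the two PUBLISHED facts and the torsion premise; nothing booked.
[cite: JetchevSkinnerWan2017, §5.1 and proof of Thm. 6.1.6 (the Σ-local display)] [cite: SkinnerUrban2014, Prop. 3.2.3]
[cite: Castella2018, Def. 2.2, (2.7), Prop. 2.5] -/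
theorem P2.RoadFF.sigmaDataAt_of_isTorsion_empty_of_satisfiesHeegnerHypothesis
    (hloc : sigmaLocal_charIdeal_eulerFactor_mem_of_noTamagawaDefect)
    (h323 : SkinnerUrban2014.prop323_XAc_equiv_XBigDecomp)
    (hp : 3 ≤ p) (hK : IsImaginaryQuadratic K) (hH : SatisfiesHeegnerHypothesis (W.conductorNorm ℤ) K)
    (hsp : SplitsIn K p) (𝔭 : HeightOneSpectrum (𝓞 K)) (h𝔭 : ((p : ℕ) : 𝓞 K) ∈ 𝔭.asIdeal)
    (κ : ZpExtension K p) (hκ : κ.IsAnticyclotomic) (γ : Field.absoluteGaloisGroup K) [Fact (κ.IsTopGenerator γ)]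
    (hT₀ : Module.IsTorsion (IwasawaAlgebra p) (XAc (W.baseChange K) p κ 𝔭 ∅ γ)) :
    P2.RoadFF.SigmaDataAt W p κ 𝔭 γ (↑(W.sigmaPlacesFinset p K) : Set (HeightOneSpectrum (𝓞 K)))
      (W.sigmaEulerElement p K κ) := by
  have hp2 : p ≠ 2 := by omega
  have hHp : SatisfiesHeegnerHypothesis p K := satisfiesHeegnerHypothesis_of_splitsIn Fact.out hsp
  have hB := noTamagawaDefect_sigmaPlaces_of_satisfiesHeegnerHypothesis W p hp2 hK hH κ hκ
  obtain ⟨hT, hCh⟩ := isTorsion_XAc_and_charIdeal_empty_mul_le_of_sigmaLocal_of_prop323 W p hp K hK hHp 𝔭 h𝔭 κ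
    hκ γ (W.sigmaPlacesFinset p K) (W.forall_mem_sigmaPlacesFinset_not_mem p K) _ _ _
    (W.isEulerDataAt_of_mem_sigmaPlacesFinset p K κ) hB hloc h323 hT₀
  exact ⟨Finset.finite_toSet _, hT, W.sigmaEulerElement_ne_zero p K κ, hCh⟩

end AllSplit

/-! ### §3 At the 3-multiplicative twin: `stub_sigmaDataMult` ⟸ torsion of `X^∅_ac(W′)` + two published facts -/

/-- **THE TWIN'S `Σ`-DATA FROM THE TORSION OF ITS `X^∅_ac`.** Under the binders of the registered stub
`stub_sigmaDataMult` (lines `threeframes` on 20694 and `membertower` on 26062): `W′/ℚ` globally minimal with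
`Mult W′ 3`, conductor `N′`, `K` imaginary quadratic with `SatisfiesHeegnerHypothesis N′ K` (so `3 ∣ N′` splits),
anticyclotomic `κ` with generator `γ`, slot `𝔭' ∋ 3` — if `X^∅_ac(W′/K_∞; slot 𝔭')` is `Λ`-torsion [the Heegner side at
`3 ∥ N′`; research / by name], then `P2.RoadFF.SigmaDataAt W′ 3 κ 𝔭' γ Σ(W′,3)(K) P_Σ` — the stub's conclusion
VERBATIM. CONDITIONAL on the PUBLISHED facts `hloc` ([JSW17] proof of Thm. 6.1.6, local display) and `h323` ([SU14]
Prop. 3.2.3) and on the torsion premise; nothing booked; BSD is proved for no curve.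
[cite: JetchevSkinnerWan2017, §5.1 and proof of Thm. 6.1.6] [cite: SkinnerUrban2014, Prop. 3.2.3]
[cite: Castella2018, Prop. 2.5 (no defect at places split in K)] -/
theorem twin_sigmaDataAt_of_isTorsion_empty
    (hloc : sigmaLocal_charIdeal_eulerFactor_mem_of_noTamagawaDefect)
    (h323 : SkinnerUrban2014.prop323_XAc_equiv_XBigDecomp)
    (W' : WeierstrassCurve ℚ) [W'.IsElliptic] [W'.IsGloballyMinimal] (N' : ℕ)
    (K : Type) [Field K] [NumberField K]
    (hm : Mult W' 3) (hN : W'.conductorNorm ℤ = N') (hK : IsImaginaryQuadratic K)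
    (hH : SatisfiesHeegnerHypothesis N' K)
    (κ : ZpExtension K 3) (hκ : κ.IsAnticyclotomic) (γ : Field.absoluteGaloisGroup K) [Fact (κ.IsTopGenerator γ)]
    (𝔭' : HeightOneSpectrum (𝓞 K)) (h𝔭' : ((3 : ℕ) : 𝓞 K) ∈ 𝔭'.asIdeal)
    (hT₀ : Module.IsTorsion (IwasawaAlgebra 3) (XAc (W'.baseChange K) 3 κ 𝔭' ∅ γ)) :
    P2.RoadFF.SigmaDataAt W' 3 κ 𝔭' γ (↑(W'.sigmaPlacesFinset 3 K) : Set (HeightOneSpectrum (𝓞 K)))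
      (W'.sigmaEulerElement 3 K κ) := by
  have hH' : SatisfiesHeegnerHypothesis (W'.conductorNorm ℤ) K := hN ▸ hH
  have hsp : SplitsIn K 3 := hH' 3 Nat.prime_three (dvd_conductorNorm_of_mult hm)
  exact P2.RoadFF.sigmaDataAt_of_isTorsion_empty_of_satisfiesHeegnerHypothesis W' 3 hloc h323 le_rfl hK hH' hsp 𝔭'
    h𝔭' κ hκ γ hT₀

end Summit.BirchSwinnertonDyer.Rank1Residual.X11b

end
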